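import Summits.BirchSwinnertonDyer.Rank1Residual.Iwasawa.UnramifiedConditionFiniteOrbit
import Summits.BirchSwinnertonDyer.Rank1Residual.X2.EulerFactorAlgebra
import Summits.BirchSwinnertonDyer.Rank1Residual.X2.LocalDeltaCalculus
import Summits.BirchSwinnertonDyer.Rank1Residual.X2.EulerFactorInvariants
import Literature.NumberTheory.EllipticCurves.ZpExtensionUnitTwistProofs
import Literature.NumberTheory.EllipticCurves.CyclotomicZpExtension
import Literature.NumberTheory.EllipticCurves.SelmerCorankControlRatProofs
import Literature.NumberTheory.EllipticCurves.SelmerFiniteProofs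
import Literature.NumberTheory.EllipticCurves.HasseWeilGoodReductionFrobeniusProofs
import Literature.NumberTheory.EllipticCurves.KodairaNeronUnramifiedInertiaProofs
import Literature.NumberTheory.GaloisRepresentations.CyclotomicCharacterFrobeniusProofs
import Literature.NumberTheory.GaloisRepresentations.DecompositionGroupOfCompletion
import Literature.NumberTheory.GaloisRepresentations.LocalGaloisGroupFrobeniusProofs
import Literature.NumberTheory.GaloisRepresentations.InertiaRootsOfUnity
import HarnessLib

/-!
# `s_ℓ` in the kernel: `Γ_ℚ = Gal(ℚ̄/ℚ_∞) · D_ℓ · {γⁿ : n < s_ℓ}` for the cyclotomic `ℤ_p`-extension —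
# the places of `ℚ_∞` above `ℓ ≠ p` are represented by `s_ℓ = p^{v_p(f_ℓ)}` powers of `γ`
# (Greenberg–Vatsal 2000 §2 p. 21); and the two local Frobenius vocabularies agree over `ℚ` — cell
# `b2b-bsdres`, unit `b2b-bsdres-eisenstein-p2`, gen 30, programme P1

HONEST FRAMING (run/shared/lean/b2b/bsd-rank1-residual/, verbatim in every file): the goal of the
cell is to DELETE the COMBINATION-SHAPED residual classes of the Birch–Swinnerton-Dyer formula for
ALL analytic-rank `≤ 1` elliptic curves over `ℚ` — "full BSD formula for every rank `≤ 1` curve in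
class `C`" assembled STRICTLY from published theorems — so that the rank-`≤ 1` remainder becomes
exactly the CONSTRUCTION-SHAPED classes, which are TYPED (missing-input `Prop`s), NOT attempted.
This is not "finishing BSD". Research route; NO CLAIM BEYOND STATED CLASSES; nothing here changes a
label. Theorems only; no definition, no named fact, no `sorry`.

* §1 `exists_forall_eq_mul_decomp_mul_pow_valuation` (any number field, any `ℤ_p`-extension `κ`):
  team n1011's `exists_forall_eq_mul_decomp_mul_pow` with the EXPONENT made explicit —
  `Γ_K = H · D_v · {γⁿ : n < p^m}` with `m = v_p(κ δ₀)` for any `δ₀ ∈ D_v` with `κ δ₀ ≠ 1`.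
* §2 **`forall_exists_lt_sFactor`** (`K = ℚ`, `κ` cyclotomic, `p` odd, `ℓ ≠ p`): every `σ ∈ Γ_ℚ` is
  `h · δ · γⁿ` with `h ∈ ker κ`, `δ ∈ D_ℓ`, `n < sFactor p ℓ = s_ℓ` — the representative property
  consumed by `NonPrimitiveQuotientCorank.zpCorank_quotient_le_sum` with `N_ℓ = s_ℓ`. Proof:
  `κ = u · (ℓog ∘ χ_p)` (`IsCyclotomic.exists_eq_unitTwist_holds` against the normalised cyclotomic
  extension `CyclotomicZp.zpExtension`), `χ_p(Frob_ℓ) = ℓ` (`cyclotomicCharacter_apply_of_isArithFrobAt`),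
  so `v_p(κ(Frob_ℓ)) = v_p(f_ℓ)` and `p^{v_p(f_ℓ)} = s_ℓ` (`pow_valuation_frobeniusExponent_eq_sFactor`).
  GV p. 21: "`s_ℓ` denotes the number of primes of `ℚ_∞` lying above `ℓ`".
* §3 `isArithFrobAt_of_isFrobPow_one` (`K = ℚ`): an arithmetic Frobenius of the `LocalGaloisGroup`
  library (`IsFrobPow φ 1`, absolute integers of the `ValuativeRel` structure) is an arithmetic
  Frobenius at every prime `𝔐 ∈ v.localPrimesAbove` of the local absolute integers
  (Mathlib `IsArithFrobAt`), through the spectral-norm characterisations of both unit balls.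

References: [GreenbergVatsal2000] §2 Prop. (2.4), p. 21, p. 30; [Washington1997] §13.1;
HOME X2-GAP.md §34.6.
-/

set_option autoImplicit false

noncomputable section

open scoped Classical NNReal

open NumberField IsDedekindDomain Field ValuativeRel
open Literature.NumberTheory.GaloisRepresentations Literature.NumberTheory.EllipticCurves
  Literature.NumberTheory.EllipticCurves.GreenbergSelmer
  Literature.NumberTheory.EllipticCurves.GreenbergVatsal2000
  Literature.NumberTheory.GaloisRepresentations.IsNonarchimedeanLocalField
  IsDedekindDomain.HeightOneSpectrum
  Summit.BirchSwinnertonDyer.Rank1Residual.Iwasawa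

universe u

namespace Summit.BirchSwinnertonDyer.Rank1Residual.X2.CyclotomicDecompositionCount

/-! ## §1. The representative property with explicit exponent -/

section Representatives

variable {K : Type u} [Field K] [NumberField K] {p : ℕ} [Fact p.Prime] (κ : ZpExtension K p)
  {v : HeightOneSpectrum (𝓞 K)}

/-- **`Γ_K = H · D_v · {γⁿ : n < p^m}` with `m = v_p(κ δ₀)`** for any `δ₀ ∈ D_v` with `κ δ₀ ≠ 1`
(n1011's `exists_forall_eq_mul_decomp_mul_pow`, exponent exposed: `n = appr (κ σ) m`, and
`κ σ − n ∈ p^m ℤ_p = κ δ₀ · ℤ_p ⊆ κ(D_v)` by `exists_mem_decomp_apply_eq_of_norm_le`).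
[cite: GreenbergVatsal2000, §2 p. 21] [cite: Washington1997, §13.1] -/
theorem exists_forall_eq_mul_decomp_mul_pow_valuation {γ : absoluteGaloisGroup K}
    (hγ : κ.IsTopGenerator γ) {δ₀ : absoluteGaloisGroup K} (hδ₀ : δ₀ ∈ decomp v) (hne : κ δ₀ ≠ 1)
    (σ : absoluteGaloisGroup K) :
    ∃ n < p ^ ((κ δ₀).toAdd).valuation, ∃ δ ∈ decomp (K := K) v, ∃ h ∈ κ.kerSubgroup,
      σ = h * (δ * γ ^ n) := by
  set a : ℤ_[p] := (κ δ₀).toAdd with ha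
  have ha0 : a ≠ 0 := fun h ↦ hne (by rw [← ofAdd_toAdd (κ δ₀), ← ha, h]; rfl)
  set x : ℤ_[p] := (κ σ).toAdd with hx
  refine ⟨x.appr a.valuation, PadicInt.appr_lt x _, ?_⟩
  have hy : ‖x - (x.appr a.valuation : ℤ_[p])‖ ≤ ‖a‖ := by
    rw [PadicInt.norm_eq_zpow_neg_valuation ha0, PadicInt.norm_le_pow_iff_mem_span_pow]
    exact PadicInt.appr_spec _ x
  obtain ⟨δ, hδ, hκδ⟩ := exists_mem_decomp_apply_eq_of_norm_le κ hδ₀ hne hy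
  refine ⟨δ, hδ, σ * (δ * γ ^ (x.appr a.valuation))⁻¹, ?_, by rw [inv_mul_cancel_right]⟩
  rw [ZpExtension.mem_kerSubgroup, map_mul, map_inv, map_mul, map_pow, hκδ, hγ,
    mul_inv_eq_one, ← ofAdd_toAdd (κ σ), ← hx, ← ofAdd_nsmul, ← ofAdd_add, nsmul_one,
    sub_add_cancel]

end Representatives

/-! ## §2. Over `ℚ`: the number of representatives is `s_ℓ` -/

section Rat

variable {p : ℕ} [hp : Fact p.Prime] (κ : ZpExtension ℚ p) {v : HeightOneSpectrum (𝓞 ℚ)}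

/-- `#k(ℚ_v) = ℓ`, `ℓ = natGenerator v`, for the `ValuativeRel` residue field of `ℚ_v`. [folklore] -/
theorem residueFieldCard_eq_natGenerator :
    residueFieldCard (v.adicCompletion ℚ) = Rat.HeightOneSpectrum.natGenerator v := by
  rw [Literature.NumberTheory.Automorphic.residueFieldCard_adicCompletion_eq,
    ← WeierstrassCurve.natCard_residueField_eq_residueCard,
    LocalDeltaCalculus.natCard_residueField_eq_natGenerator]

/-- **`χ_p(res τ) = ℓ`** for an absolute arithmetic Frobenius `τ` of `ℚ_ℓ` (`ℓ ≠ p`), in `ℤ_p`.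
[cite: Washington1997, §13.1] -/
theorem cyclotomicCharacter_absGaloisRestrict_of_isAbsArithFrob (hpv : ((p : ℕ) : 𝓞 ℚ) ∉ v.asIdeal)
    {τ : absoluteGaloisGroup (v.adicCompletion ℚ)} (hτ : IsAbsArithFrob τ) :
    ((GaloisRep.cyclotomicCharacter ℚ p (absGaloisRestrict ℚ (v.adicCompletion ℚ) τ) : ℤ_[p]ˣ) :
        ℤ_[p]) = (Rat.HeightOneSpectrum.natGenerator v : ℤ_[p]) := by
  have hq : residueFieldCard (v.adicCompletion ℚ) = Nat.card (𝓞 ℚ ⧸ v.asIdeal) := by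
    rw [Literature.NumberTheory.Automorphic.residueFieldCard_adicCompletion_eq,
      HeightOneSpectrum.residueCard_eq_card_quotient]
  have hfrob := (isArithFrobAt_absGaloisRestrict_adicCompletionPrime_iff ℚ v hq τ).2 hτ
  rw [GaloisRep.cyclotomicCharacter_apply_of_isArithFrobAt (ℓ := p) hpv
    (adicCompletionPrime_mem_primesAbove ℚ v) hfrob,
    ← Literature.NumberTheory.Automorphic.residueFieldCard_adicCompletion_eq,
    residueFieldCard_eq_natGenerator]

/-- **The places of `ℚ_∞` above `ℓ ≠ p` are represented by `s_ℓ` powers of `γ`**: for the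
CYCLOTOMIC `ℤ_p`-extension `κ` of `ℚ` (`p` odd) with topological generator `γ`, every `σ ∈ Γ_ℚ` is
`h · δ · γⁿ` with `h ∈ ker κ = Gal(ℚ̄/ℚ_∞)`, `δ ∈ D_ℓ` and `n < s_ℓ = sFactor p ℓ`. Indeed
`κ = u · ℓog ∘ χ_p` for a unit `u` (uniqueness of the cyclotomic `ℤ_p`-extension up to `ℤ_pˣ`), so
`κ(Frob_ℓ) = u · f_ℓ` has `p`-adic valuation `v_p(f_ℓ)` and `p^{v_p(f_ℓ)} = s_ℓ`
(`EulerFactorAlgebra.pow_valuation_frobeniusExponent_eq_sFactor`); then §1. GV p. 21 ("`s_ℓ` denotes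
the number of primes of `ℚ_∞` lying above `ℓ`"), p. 9 ("`f_ℓ ∈ ℤ_p` is determined by `γ^{f_ℓ} = γ_ℓ`").
[cite: GreenbergVatsal2000, §2 Prop. (2.4) and p. 21] [cite: Washington1997, §13.1] -/
theorem forall_exists_lt_sFactor (hκ : κ.IsCyclotomic) {γ : absoluteGaloisGroup ℚ}
    (hγ : κ.IsTopGenerator γ) (hp2 : p ≠ 2) (hpv : ((p : ℕ) : 𝓞 ℚ) ∉ v.asIdeal)
    (σ : absoluteGaloisGroup ℚ) :
    ∃ n < sFactor p (Rat.HeightOneSpectrum.natGenerator v), ∃ δ ∈ decomp (K := ℚ) v,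
      ∃ h ∈ κ.kerSubgroup, σ = h * (δ * γ ^ n) := by
  set ℓ := Rat.HeightOneSpectrum.natGenerator v with hℓ
  have hℓp : ℓ ≠ p := EulerFactorInvariants.natGenerator_ne_of_natCast_not_mem v hpv
  have hℓprime : ℓ.Prime := Rat.HeightOneSpectrum.prime_natGenerator v
  have hcop : p.Coprime ℓ := (Nat.coprime_primes hp.out hℓprime).2 (Ne.symm hℓp)
  have h1ℓ : 1 < ℓ := hℓprime.one_lt
  -- a Frobenius `δ₀ = res τ`
  obtain ⟨τ, hτ⟩ := exists_isAbsArithFrob_holds (F := v.adicCompletion ℚ)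
  set δ₀ := absGaloisRestrict ℚ (v.adicCompletion ℚ) τ with hδ₀
  have hδ₀D : δ₀ ∈ decomp (K := ℚ) v := ⟨τ, rfl⟩
  have hχ : ((GaloisRep.cyclotomicCharacter ℚ p δ₀ : ℤ_[p]ˣ) : ℤ_[p]) = (ℓ : ℤ_[p]) :=
    cyclotomicCharacter_absGaloisRestrict_of_isAbsArithFrob hpv hτ
  -- `κ = u · ℓog ∘ χ_p`
  obtain ⟨u, hu⟩ := ZpExtension.IsCyclotomic.exists_eq_unitTwist_holds
    (CyclotomicZp.isCyclotomic_zpExtension p) hκ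
  have hκδ₀ : (κ δ₀).toAdd = (u : ℤ_[p]) * frobeniusExponent p (ℓ : ℤ_[p]) := by
    rw [hu, ZpExtension.unitTwist_apply, toAdd_ofAdd, CyclotomicZp.zpExtension_apply, toAdd_ofAdd,
      frobeniusExponent_of_isUnit (EulerFactorAlgebra.isUnit_natCast_of_coprime hcop)]
    congr 2
    exact Units.ext (by rw [hχ, IsUnit.unit_spec])
  have hf0 : frobeniusExponent p (ℓ : ℤ_[p]) ≠ 0 :=
    EulerFactorAlgebra.frobeniusExponent_natCast_ne_zero hcop h1ℓ
  have hu0 : (u : ℤ_[p]) ≠ 0 := Units.ne_zero u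
  have hne : κ δ₀ ≠ 1 := by
    intro h1
    have h0 : (κ δ₀).toAdd = 0 := by rw [h1]; rfl
    rw [hκδ₀] at h0
    exact (mul_ne_zero hu0 hf0) h0
  have hval : ((κ δ₀).toAdd).valuation = (frobeniusExponent p (ℓ : ℤ_[p])).valuation := by
    rw [hκδ₀, PadicInt.valuation_mul hu0 hf0]
    have hu1 : ((u : ℤ_[p])).valuation = 0 := by
      have h := PadicInt.norm_eq_zpow_neg_valuation hu0
      rw [PadicInt.norm_units] at h
      have h' : ((p : ℝ) ^ (-((u : ℤ_[p]).valuation : ℤ))) = (p : ℝ) ^ (0 : ℤ) := by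
        rw [zpow_zero]; exact h.symm
      have hinj := (zpow_right_strictMono₀ (a := (p : ℝ)) (by exact_mod_cast hp.out.one_lt)).injective h'
      omega
    rw [hu1, zero_add]
  have hpow : p ^ ((κ δ₀).toAdd).valuation = sFactor p ℓ := by
    rw [hval, EulerFactorAlgebra.pow_valuation_frobeniusExponent_eq_sFactor hp2 hcop h1ℓ]
  rw [← hpow]
  exact exists_forall_eq_mul_decomp_mul_pow_valuation κ hγ hδ₀D hne σ

/-! ## §3. Over `ℚ`: `IsFrobPow φ 1` implies `IsArithFrobAt` at the primes of the local absolute integers -/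

/-- **An arithmetic Frobenius `φ` of `ℚ_v` in the `LocalGaloisGroup` sense (`IsFrobPow φ 1`:
`φ x ≡ x^{q}` modulo the maximal ideal of the absolute integers of the `ValuativeRel` structure) is
an arithmetic Frobenius at every `𝔐 ∈ v.localPrimesAbove`** (Mathlib `IsArithFrobAt` for the local
absolute integers over `v.adicCompletionIntegers ℚ`): both unit balls are `{‖x‖ ≤ 1}` and both
maximal ideals `{‖x‖ < 1}` for the spectral norm, and both exponents are `ℓ`. [folklore] -/
theorem isArithFrobAt_of_isFrobPow_one {φ : absoluteGaloisGroup (v.adicCompletion ℚ)}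
    (hφ : IsFrobPow φ 1) {𝔐 : Ideal v.localAbsIntegers} (h𝔐 : 𝔐 ∈ v.localPrimesAbove) :
    IsArithFrobAt (v.adicCompletionIntegers ℚ) φ 𝔐 := by
  obtain ⟨w, hw⟩ := v.exists_spectralValuation
  have hcard : Nat.card (v.adicCompletionIntegers ℚ ⧸ Ideal.under (v.adicCompletionIntegers ℚ) 𝔐) =
      residueFieldCard (v.adicCompletion ℚ) := by
    rw [natCard_quotient_under_eq_of_mem_localPrimesAbove v h𝔐,
      LocalDeltaCalculus.natCard_residueField_eq_natGenerator, residueFieldCard_eq_natGenerator]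
  intro x
  rw [hcard]
  -- freeze the exponent (no unfolding of `Nat.card` during unification)
  obtain ⟨q, hq⟩ : ∃ q : ℕ, residueFieldCard (v.adicCompletion ℚ) = q := ⟨_, rfl⟩
  rw [hq]
  -- `x` as an absolute integer of the `ValuativeRel` structure
  have hx1 : w (x : AlgebraicClosure (v.adicCompletion ℚ)) ≤ 1 :=
    (mem_localAbsIntegers_iff_spectralValuation hw).1 x.2
  have hxmem : (x : AlgebraicClosure (v.adicCompletion ℚ)) ∈
      absIntegers 𝒪[v.adicCompletion ℚ] (v.adicCompletion ℚ) :=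
    mem_absIntegers_iff_algNorm_le_one.2 ((spectralValuation_le_one_iff_algNorm_le_one hw _).1 hx1)
  have h := (isFrobPow_natCast_iff (n := 1)).1 hφ ⟨_, hxmem⟩
  rw [pow_one, hq] at h
  have hlt := mem_absMaximalIdeal_iff_algNorm_lt_one.1 h
  have hlt' : algNorm (v.adicCompletion ℚ)
      (φ • (x : AlgebraicClosure (v.adicCompletion ℚ)) -
        (x : AlgebraicClosure (v.adicCompletion ℚ)) ^ q) < 1 := hlt
  rw [← spectralValuation_lt_one_iff_algNorm_lt_one hw] at hlt'
  have hmem := (mem_iff_spectralValuation_lt_one hw h𝔐 (b := φ • x - x ^ q)).2 hlt'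
  exact hmem

end Rat

end Summit.BirchSwinnertonDyer.Rank1Residual.X2.CyclotomicDecompositionCount

end
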